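import Mathlib.RepresentationTheory.Irreducible
import Mathlib.GroupTheory.FreeGroup.Basic
import Mathlib.LinearAlgebra.Dual.Lemmas
import Mathlib.LinearAlgebra.FiniteDimensional.Lemmas
import Mathlib.Algebra.BigOperators.Fin
import HarnessLib

/-!
# Scott's lemma on tuples of matrices with product one

Topic `Literature/AlgebraicGeometry/Motives` (support for the Katz–Dettweiler–Reiter theory of rigid
tuples, `RigidTuples.lean`).  For linear maps `σ₀, …, σ_{p-1}` of a finite-dimensional vector
space `W` with `σ₀ ∘ σ₁ ∘ ⋯ ∘ σ_{p-1} = 1` write `F(σ) = ker(σ - 1)` for the fixed space,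
`F(Σ) = ⋂ᵢ F(σᵢ)` and `F(Σ*) = {λ ∈ W* | λ ∘ σᵢ = λ ∀ i}` (the functionals fixed by the transposes),
and `d = codim F`.  **Scott's lemma** [Scott1977, Thm. 1] (in the form of [Haraoka2020, Lemma 7.9];
[DettweilerReiter2000, Lemma 4.5] is its corollary for irreducible tuples) is the inequality

  `d(σ₀) + ⋯ + d(σ_{p-1}) ≥ d(Σ) + d(Σ*)`.

This is the dimension count behind Katz's criterion "index of rigidity `2` ⟹ physically rigid"
([Katz1996, Thm. 1.1.2]; [DettweilerReiter2000, Lemma 4.7]; [Haraoka2020, Thm. 7.8]), applied there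
to `W = End V`, `σᵢ(A) = Tᵢ A T'ᵢ⁻¹` (file `RigidTuplesProofs.lean`), and behind the rank step of
Katz's existence algorithm ([DettweilerReiter2000, Lemma 4.5 in the proof of Thm. 4.9]).

## Main statements

* `scott_finrank_le`: Scott's lemma in additive `finrank` form (no subtraction):
  `2·dim W + Σᵢ dim F(σᵢ) ≤ dim F(Σ) + dim F(Σ*) + p·dim W`.
* `RigidTuple.scott_two_mul_finrank_le_sum_rank`: [DettweilerReiter2000, Lemma 4.5] — for an
  irreducible tuple `T = (T_i)` in `GL(V)`, `dim V ≥ 2`, with `T_∞ = 1`: `Σᵢ rk(Tᵢ - 1) ≥ 2·dim V`.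

## The proof ([Haraoka2020, proof of Lemma 7.9], followed verbatim)

Let `C = ⊕ᵢ (σᵢ - 1)W`, `β : W → C`, `v ↦ ((σᵢ - 1)v)ᵢ` and `δ : C → W`,
`(vᵢ) ↦ Σᵢ Pᵢ vᵢ` with the prefix products `Pᵢ = σ₀ ⋯ σ_{i-1} = ((List.ofFn σ).take i).prod`.  Then
`δ ∘ β = Σᵢ (P_{i+1} - Pᵢ) = P_p - P₀ = 0` (telescoping; this is where the product `= 1` enters),
`ker β = F(Σ)`, and a functional killing `range δ` is fixed by every `σᵢ` (induction on `i`: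
`λ Pᵢ (σᵢ - 1) = 0` and `λ Pᵢ = λ` give `λ P_{i+1} = λ`), so `rank δ ≥ dim W - dim F(Σ*)`.  Hence
`Σ d(σᵢ) = dim C = rank δ + dim ker δ ≥ rank δ + rank β ≥ (dim W - dim F(Σ*)) + (dim W - dim F(Σ))`.

## Remarks on the printed statements

[DettweilerReiter2000, Lemma 4.5] reads "Let `T` be a tuple in `GL_n(K)` such that `T_∞ = 1`. If the
group `⟨T⟩` is irreducible then `Σ rk(Tᵢ - 1) ≥ 2n`"; for `n = 1` and the trivial tuple
`T = (1,…,1)` (whose group `{1}` does act irreducibly on `K¹`) the left side is `0`, so we state it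
for `n ≥ 2`, the case used in [DettweilerReiter2000, proof of Thm. 4.9] ("`n ≥ 2`").  No algebraic closedness and no
invertibility of the `σᵢ` is needed for `scott_finrank_le`.

## References
* L. L. Scott, *Matrices and cohomology*, Ann. of Math. 105 (1977) 473–492, Thm. 1 [Scott1977].
* Y. Haraoka, *Linear Differential Equations in the Complex Domain*, LNM 2271, Springer 2020,
  Lemma 7.9 [Haraoka2020].
* M. Dettweiler, S. Reiter, *An algorithm of Katz …*, J. Symbolic Comput. 30 (2000), Lemma 4.5
  [DettweilerReiter2000].
* N. M. Katz, *Rigid Local Systems*, 1996, Thm. 1.1.2 [Katz1996].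
-/

noncomputable section

namespace Literature.AlgebraicGeometry.Motives

open Module

section Scott

variable {K : Type*} [Field K] {W : Type*} [AddCommGroup W] [Module K W] {p : ℕ}

/-- Prefix products `P_k = σ₀ ∘ ⋯ ∘ σ_{k-1} = ((List.ofFn σ).take k).prod`: `P_0 = 1`. [folklore] -/
theorem ofFn_take_prod_zero (σ : Fin p → Module.End K W) : ((List.ofFn σ).take 0).prod = 1 := by
  simp

/-- `P_{k+1} = P_k σ_k` (this is `Fin.partialProd_succ`). [folklore] -/
theorem ofFn_take_prod_succ (σ : Fin p → Module.End K W) {k : ℕ} (hk : k < p) :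
    ((List.ofFn σ).take (k + 1)).prod = ((List.ofFn σ).take k).prod * σ ⟨k, hk⟩ :=
  Fin.partialProd_succ σ ⟨k, hk⟩

/-- `P_p = σ₀ ⋯ σ_{p-1}`. [folklore] -/
theorem ofFn_take_prod_length (σ : Fin p → Module.End K W) :
    ((List.ofFn σ).take p).prod = (List.ofFn σ).prod := by
  rw [List.take_of_length_le (by simp)]

/-- **Scott's lemma** ([Scott1977, Thm. 1]; the form and proof of [Haraoka2020, Lemma 7.9]): for
endomorphisms `σ₀, …, σ_{p-1}` of a finite-dimensional space `W` with `σ₀ ∘ ⋯ ∘ σ_{p-1} = 1`,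
`Σᵢ codim F(σᵢ) ≥ codim F(Σ) + codim F(Σ*)` where `F(σᵢ) = ker(σᵢ - 1)`, `F(Σ) = ⋂ᵢ F(σᵢ)` and
`F(Σ*) = {λ ∈ W* | λ ∘ σᵢ = λ ∀ i} = ⋂ᵢ ker(σᵢᵀ - 1)`; written additively:
`2·dim W + Σᵢ dim F(σᵢ) ≤ dim F(Σ) + dim F(Σ*) + p·dim W`. [cite: Haraoka2020, Lemma 7.9] -/
theorem scott_finrank_le [FiniteDimensional K W] (σ : Fin p → Module.End K W)
    (hσ : (List.ofFn σ).prod = 1) :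
    2 * finrank K W + ∑ i, finrank K (LinearMap.ker (σ i - 1)) ≤
      finrank K (⨅ i, LinearMap.ker (σ i - 1) : Submodule K W) +
        finrank K (⨅ i, LinearMap.ker ((σ i).dualMap - 1) : Submodule K (Module.Dual K W)) +
        p * finrank K W := by
  classical
  -- the complex `W —β→ C —δ→ W`
  let C := (i : Fin p) → LinearMap.range (σ i - 1)
  let β : W →ₗ[K] C := LinearMap.pi fun i => (σ i - 1).rangeRestrict
  let δ : C →ₗ[K] W :=
    ∑ i : Fin p, (((List.ofFn σ).take (i : ℕ)).prod ∘ₗ (LinearMap.range (σ i - 1)).subtype) ∘ₗ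
      LinearMap.proj i
  have hδapply : ∀ c : C, δ c = ∑ i : Fin p, ((List.ofFn σ).take (i : ℕ)).prod (c i) := by
    intro c
    change (∑ i : Fin p,
      (((List.ofFn σ).take (i : ℕ)).prod ∘ₗ (LinearMap.range (σ i - 1)).subtype) ∘ₗ
        LinearMap.proj i) c = _
    rw [LinearMap.sum_apply]
    rfl
  have hbapply : ∀ (i : Fin p) (v : W), ((List.ofFn σ).take i).prod ((σ i - 1) v) =
      ((List.ofFn σ).take (i + 1)).prod v - ((List.ofFn σ).take i).prod v := by
    intro i v
    rw [ofFn_take_prod_succ σ i.isLt]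
    simp [Module.End.mul_apply]
  -- (1) `δ ∘ β = 0` (telescoping, uses `σ₀ ⋯ σ_{p-1} = 1`)
  have hδβ : δ ∘ₗ β = 0 := by
    ext v
    rw [LinearMap.comp_apply, hδapply, LinearMap.zero_apply]
    have : ∀ i : Fin p, ((List.ofFn σ).take i).prod ((β v) i) =
        ((List.ofFn σ).take (i + 1)).prod v - ((List.ofFn σ).take i).prod v := by
      intro i
      rw [← hbapply]
      rfl
    simp_rw [this]
    rw [Fin.sum_univ_eq_sum_range
        (fun k => ((List.ofFn σ).take (k + 1)).prod v - ((List.ofFn σ).take k).prod v) p,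
      Finset.sum_range_sub (fun k => ((List.ofFn σ).take k).prod v), ofFn_take_prod_zero,
      ofFn_take_prod_length, hσ, sub_self]
  -- (2) `δ` on a single component
  have hδsingle : ∀ (i : Fin p) (x : LinearMap.range (σ i - 1)),
      δ (Pi.single i x) = ((List.ofFn σ).take i).prod x := by
    intro i x
    rw [hδapply, Finset.sum_eq_single i]
    · rw [Pi.single_eq_same]
    · intro j _ hji
      rw [Pi.single_eq_of_ne hji]
      simp
    · intro h
      exact absurd (Finset.mem_univ i) h
  -- (3) a functional killing `range δ` is fixed by all `σᵢ`
  have hannle : (LinearMap.range δ).dualAnnihilator ≤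
      ⨅ i, LinearMap.ker ((σ i).dualMap - 1) := by
    intro l hl
    rw [Submodule.mem_dualAnnihilator] at hl
    have key : ∀ k, k ≤ p → l ∘ₗ ((List.ofFn σ).take k).prod = l := by
      intro k
      induction k with
      | zero =>
        intro _
        rw [ofFn_take_prod_zero, Module.End.one_eq_id, LinearMap.comp_id]
      | succ k ih =>
        intro hk
        have hk' : k < p := hk
        have ih' := ih hk'.le
        rw [ofFn_take_prod_succ σ hk']
        ext w
        have hmem : ((List.ofFn σ).take k).prod ((σ ⟨k, hk'⟩ - 1) w) ∈ LinearMap.range δ :=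
          ⟨Pi.single ⟨k, hk'⟩ ⟨(σ ⟨k, hk'⟩ - 1) w, LinearMap.mem_range_self _ w⟩, hδsingle _ _⟩
        have h0 := hl _ hmem
        have h1 : l (((List.ofFn σ).take k).prod w) = l w := LinearMap.congr_fun ih' w
        simp only [LinearMap.sub_apply, Module.End.one_apply, map_sub, h1] at h0
        simp only [LinearMap.coe_comp, Function.comp_apply, Module.End.mul_apply]
        exact sub_eq_zero.1 h0
    rw [Submodule.mem_iInf]
    intro i
    rw [LinearMap.mem_ker, LinearMap.sub_apply, sub_eq_zero, LinearMap.dualMap_apply',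
      Module.End.one_apply]
    calc l ∘ₗ σ i = (l ∘ₗ ((List.ofFn σ).take i).prod) ∘ₗ σ i := by rw [key i i.isLt.le]
      _ = l ∘ₗ ((List.ofFn σ).take (i + 1)).prod := by
          rw [ofFn_take_prod_succ σ i.isLt, Module.End.mul_eq_comp, LinearMap.comp_assoc]
      _ = l := key (i + 1) i.isLt
  -- (4) dimension bookkeeping
  have hC : finrank K C = ∑ i, finrank K (LinearMap.range (σ i - 1)) :=
    Module.finrank_pi_fintype K
  have hrk : ∀ i, finrank K (LinearMap.range (σ i - 1)) + finrank K (LinearMap.ker (σ i - 1)) =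
      finrank K W := fun i => LinearMap.finrank_range_add_finrank_ker (σ i - 1)
  have hδrk := LinearMap.finrank_range_add_finrank_ker δ
  have hβrk := LinearMap.finrank_range_add_finrank_ker β
  have hkerβ : LinearMap.ker β = ⨅ i, LinearMap.ker (σ i - 1) := by
    rw [LinearMap.ker_pi]
    simp
  have hβδ : finrank K (LinearMap.range β) ≤ finrank K (LinearMap.ker δ) :=
    Submodule.finrank_mono (LinearMap.range_le_ker_iff.2 hδβ)
  have hann := Subspace.finrank_add_finrank_dualAnnihilator_eq (LinearMap.range δ)
  have hannfin := Submodule.finrank_mono hannle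
  have hsum : ∑ i, finrank K (LinearMap.range (σ i - 1)) +
      ∑ i, finrank K (LinearMap.ker (σ i - 1)) = p * finrank K W := by
    rw [← Finset.sum_add_distrib, Finset.sum_congr rfl fun i _ => hrk i, Finset.sum_const,
      Finset.card_univ, Fintype.card_fin, smul_eq_mul]
  rw [← hkerβ]
  generalize p * finrank K W = pn at hsum ⊢
  omega

end Scott

/-! ### Representations of free groups: what the generators decide -/

namespace RigidTuple

variable {K : Type*} [Field K] {V : Type*} [AddCommGroup V] [Module K V]

/-- A vector fixed by the free generators is fixed by the free group. [folklore] -/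
theorem apply_eq_self_of_generators {ι : Type*} (ρ : Representation K (FreeGroup ι) V) {v : V}
    (h : ∀ i, ρ (FreeGroup.of i) v = v) (g : FreeGroup ι) : ρ g v = v := by
  induction g using FreeGroup.induction_on with
  | C1 => simp
  | of i => exact h i
  | inv_of i _ =>
    calc ρ (FreeGroup.of i)⁻¹ v = ρ (FreeGroup.of i)⁻¹ (ρ (FreeGroup.of i) v) := by rw [h i]
      _ = v := ρ.inv_self_apply _ _
  | mul x y hx hy => rw [map_mul, Module.End.mul_apply, hy, hx]

/-- A linear map intertwining two representations of a free group on the free generators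
intertwines them. [folklore] -/
theorem comp_eq_comp_of_generators {ι : Type*} {V' : Type*} [AddCommGroup V'] [Module K V']
    (ρ : Representation K (FreeGroup ι) V) (ρ' : Representation K (FreeGroup ι) V')
    (B : V →ₗ[K] V') (h : ∀ i, B ∘ₗ ρ (FreeGroup.of i) = ρ' (FreeGroup.of i) ∘ₗ B)
    (g : FreeGroup ι) : B ∘ₗ ρ g = ρ' g ∘ₗ B := by
  induction g using FreeGroup.induction_on with
  | C1 =>
    ext v
    simp
  | of i => exact h i
  | inv_of i ih =>
    ext v
    have hw := LinearMap.congr_fun ih (ρ (FreeGroup.of i)⁻¹ v)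
    simp only [LinearMap.coe_comp, Function.comp_apply, Representation.self_inv_apply] at hw
    simp only [LinearMap.coe_comp, Function.comp_apply]
    rw [hw, Representation.inv_self_apply]
  | mul x y hx hy =>
    rw [map_mul, map_mul, Module.End.mul_eq_comp, Module.End.mul_eq_comp, ← LinearMap.comp_assoc,
      hx, LinearMap.comp_assoc, hy, LinearMap.comp_assoc]

/-- A functional fixed by (the transposes of) the free generators is fixed by the free group.
[folklore] -/
theorem dual_comp_eq_self_of_generators {ι : Type*} (ρ : Representation K (FreeGroup ι) V)
    {l : Module.Dual K V} (h : ∀ i, l ∘ₗ ρ (FreeGroup.of i) = l) (g : FreeGroup ι) :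
    l ∘ₗ ρ g = l := by
  induction g using FreeGroup.induction_on with
  | C1 => rw [map_one, Module.End.one_eq_id, LinearMap.comp_id]
  | of i => exact h i
  | inv_of i _ =>
    calc l ∘ₗ ρ (FreeGroup.of i)⁻¹ = (l ∘ₗ ρ (FreeGroup.of i)) ∘ₗ ρ (FreeGroup.of i)⁻¹ := by
          rw [h i]
      _ = l := by
          ext v
          simp
  | mul x y hx hy =>
    rw [map_mul, Module.End.mul_eq_comp, ← LinearMap.comp_assoc, hx, hy]

variable {r : ℕ}

/-- For an irreducible representation of dimension `≥ 2` of a free group, no nonzero vector is fixed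
by all the generators. [folklore] -/
theorem iInf_ker_sub_one_eq_bot (ρ : Representation K (FreeGroup (Fin r)) V)
    (hirr : ρ.IsIrreducible) (hV : 2 ≤ finrank K V) :
    (⨅ i, LinearMap.ker (ρ (FreeGroup.of i) - 1) : Submodule K V) = ⊥ := by
  haveI := hirr
  have hV' : FiniteDimensional K V := Module.finite_of_finrank_pos (by omega)
  set F : Submodule K V := ⨅ i, LinearMap.ker (ρ (FreeGroup.of i) - 1) with hF
  have hmem : ∀ {v : V}, v ∈ F ↔ ∀ i, ρ (FreeGroup.of i) v = v := by
    intro v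
    simp [hF, Submodule.mem_iInf, sub_eq_zero]
  -- `F` is a subrepresentation, hence `⊥` or `⊤`
  let F' : Subrepresentation ρ := ⟨F, fun g v hv => hmem.2 fun i => by
    rw [apply_eq_self_of_generators ρ (hmem.1 hv) g]
    exact hmem.1 hv i⟩
  rcases IsSimpleOrder.eq_bot_or_eq_top F' with h | h
  · exact congrArg Subrepresentation.toSubmodule h
  · -- all `T_i = 1`: every line is a subrepresentation, contradicting `dim V ≥ 2`
    exfalso
    have htop : F = ⊤ := congrArg Subrepresentation.toSubmodule h
    have hall : ∀ (g : FreeGroup (Fin r)) (v : V), ρ g v = v := fun g v =>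
      apply_eq_self_of_generators ρ (hmem.1 (htop ▸ Submodule.mem_top)) g
    haveI : Nontrivial V := Module.nontrivial_of_finrank_pos (R := K) (by omega)
    obtain ⟨v, hv⟩ := exists_ne (0 : V)
    let L : Subrepresentation ρ := ⟨K ∙ v, fun g w hw => by rwa [hall g w]⟩
    rcases IsSimpleOrder.eq_bot_or_eq_top L with hL | hL
    · have : v ∈ (L : Subrepresentation ρ).toSubmodule := Submodule.mem_span_singleton_self v
      rw [hL] at this
      exact hv ((Submodule.mem_bot K).1 this)
    · have hL' : (K ∙ v) = ⊤ := congrArg Subrepresentation.toSubmodule hL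
      have := finrank_span_singleton (K := K) hv
      rw [hL', finrank_top] at this
      omega

/-- For an irreducible representation of dimension `≥ 2` of a free group, no nonzero functional is
fixed by (the transposes of) all the generators. [folklore] -/
theorem iInf_ker_dualMap_sub_one_eq_bot (ρ : Representation K (FreeGroup (Fin r)) V)
    (hirr : ρ.IsIrreducible) (hV : 2 ≤ finrank K V) :
    (⨅ i, LinearMap.ker ((ρ (FreeGroup.of i)).dualMap - 1) : Submodule K (Module.Dual K V)) =
      ⊥ := by
  haveI := hirr
  have hV' : FiniteDimensional K V := Module.finite_of_finrank_pos (by omega)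
  rw [Submodule.eq_bot_iff]
  intro l hl
  have hl' : ∀ i, l ∘ₗ ρ (FreeGroup.of i) = l := by
    intro i
    have := (Submodule.mem_iInf _).1 hl i
    rwa [LinearMap.mem_ker, LinearMap.sub_apply, sub_eq_zero, LinearMap.dualMap_apply',
      Module.End.one_apply] at this
  -- `ker l` is a subrepresentation, hence `⊥` (impossible by dimension) or `⊤` (`l = 0`)
  let L : Subrepresentation ρ := ⟨LinearMap.ker l, fun g w hw => by
    rw [LinearMap.mem_ker] at hw ⊢
    rw [← LinearMap.comp_apply, dual_comp_eq_self_of_generators ρ hl' g, hw]⟩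
  rcases IsSimpleOrder.eq_bot_or_eq_top L with hL | hL
  · exfalso
    have hker : LinearMap.ker l = ⊥ := congrArg Subrepresentation.toSubmodule hL
    have := LinearMap.finrank_le_finrank_of_injective (LinearMap.ker_eq_bot.1 hker)
    rw [Module.finrank_self] at this
    omega
  · exact LinearMap.ker_eq_top.1 (congrArg Subrepresentation.toSubmodule hL)

/-- **Scott's lemma for irreducible tuples** ([DettweilerReiter2000, Lemma 4.5], after
[Scott1977]): let `T = (T_i)_{i<r}` be a tuple in `GL(V)`, `dim V ≥ 2`, acting irreducibly, with
`T_∞ = T₀ ∘ ⋯ ∘ T_{r-1} = 1`. Then `Σᵢ rk(Tᵢ - 1) ≥ 2·dim V`.  (Printed for all `n`; false for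
`n = 1` and the trivial tuple, see the module docstring — the proof of [DettweilerReiter2000, Thm. 4.9]
uses it for `n ≥ 2`.)  From `scott_finrank_le` with `W = V`, `σᵢ = Tᵢ`, where both fixed spaces
vanish by irreducibility. [cite: DettweilerReiter2000, Lemma 4.5] -/
theorem scott_two_mul_finrank_le_sum_rank (ρ : Representation K (FreeGroup (Fin r)) V)
    (hirr : ρ.IsIrreducible) (hV : 2 ≤ finrank K V)
    (h1 : (List.ofFn fun i => ρ (FreeGroup.of i)).prod = 1) :
    2 * finrank K V ≤ ∑ i, finrank K (LinearMap.range (ρ (FreeGroup.of i) - 1)) := by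
  have hV' : FiniteDimensional K V := Module.finite_of_finrank_pos (by omega)
  have hS := scott_finrank_le (fun i => ρ (FreeGroup.of i)) h1
  rw [iInf_ker_sub_one_eq_bot ρ hirr hV, iInf_ker_dualMap_sub_one_eq_bot ρ hirr hV, finrank_bot,
    finrank_bot] at hS
  have hrk : ∀ i : Fin r, finrank K (LinearMap.range (ρ (FreeGroup.of i) - 1)) +
      finrank K (LinearMap.ker (ρ (FreeGroup.of i) - 1)) = finrank K V := fun i =>
    LinearMap.finrank_range_add_finrank_ker _
  have hsum : ∑ i, finrank K (LinearMap.range (ρ (FreeGroup.of i) - 1)) +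
      ∑ i, finrank K (LinearMap.ker (ρ (FreeGroup.of i) - 1)) = r * finrank K V := by
    rw [← Finset.sum_add_distrib, Finset.sum_congr rfl fun i _ => hrk i, Finset.sum_const,
      Finset.card_univ, Fintype.card_fin, smul_eq_mul]
  generalize r * finrank K V = rn at hsum hS
  omega

end RigidTuple

end Literature.AlgebraicGeometry.Motives

end
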